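import Literature.Probability.LatticeModels.LatticeGraph

/-!
# Crux `AnchorGap` (stmt-QuantumFields-11141), line `registered` — blocking of the discrete torus

Geometry helper toward stub `stub_sgRepCore` of the skeleton `Cruxes/AnchorGap/Lines/birth.lean`
(the block / sector decomposition of the polymer representation on the discrete torus
`TorusSite 3 N = (ℤ/N)³`): for every block scale `1 ≤ ℓ ≤ N` the torus `(ℤ/N)³` is partitioned
into boxes `∏ᵢ [ancᵢ, ancᵢ + Lᵢ)` with all sides `ℓ ≤ Lᵢ < 2ℓ`, each box labelled by its corner
`anc` (an idempotent "anchor" map).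

Proof: one-dimensional first.  Write `N = q ℓ + r` with `q ≥ 1`, `0 ≤ r < ℓ` and cut `[0, N)` into
the intervals `[0, ℓ), [ℓ, 2ℓ), …, [(q-2)ℓ, (q-1)ℓ)` of length `ℓ` and the last interval
`[(q-1)ℓ, N)` of length `ℓ + r < 2ℓ` (`nat_blocking`: the anchor of `m` is `(q-1)ℓ` if
`m ≥ (q-1)ℓ` and `⌊m/ℓ⌋ ℓ` otherwise).  Transport to `ZMod N` through `ZMod.val`
(`(w - c).val < L ↔ c.val ≤ w.val < c.val + L` when `c.val + L ≤ N`, `zmod_val_sub_lt_iff`), and take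
the product over the three coordinates.
-/

set_option autoImplicit false

namespace Summit.QuantumFields.YangMills.Theorems.AnchorGap

open Literature.Probability.LatticeModels

/-- **Blocking of `[0, N)` into intervals of length in `[ℓ, 2ℓ)`.** For `ℓ ≥ 1` and
`k ℓ + ℓ ≤ N < k ℓ + 2ℓ` there are an anchor map `A` and a length map `len` on `ℕ` with `A m ≤ m`,
`A (A m) = A m`, `ℓ ≤ len (A m) < 2ℓ`, `A m + len (A m) ≤ N`, and, for `m' < N`,
`A m' = A m ↔ m' ∈ [A m, A m + len (A m))`: take `A m = k ℓ` if `m ≥ k ℓ` and `A m = ⌊m/ℓ⌋ ℓ`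
otherwise, `len a = N - k ℓ` if `a ≥ k ℓ` and `len a = ℓ` otherwise. [folklore] -/
theorem nat_blocking (ℓ N k : ℕ) (hℓ : 1 ≤ ℓ) (hP : k * ℓ + ℓ ≤ N) (hN : N < k * ℓ + 2 * ℓ) :
    ∃ (A len : ℕ → ℕ), (∀ m, A m ≤ m) ∧ (∀ m, A (A m) = A m) ∧
      (∀ m, ℓ ≤ len (A m) ∧ len (A m) < 2 * ℓ) ∧ (∀ m, A m + len (A m) ≤ N) ∧
      (∀ m m', m' < N → (A m' = A m ↔ A m ≤ m' ∧ m' < A m + len (A m))) := by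
  have hℓpos : 0 < ℓ := hℓ
  -- rounding down to a multiple of `ℓ`
  set B : ℕ → ℕ := fun m => m / ℓ * ℓ with hBdef
  have hB1 : ∀ m, B m ≤ m := fun m => Nat.div_mul_le_self m ℓ
  have hB2 : ∀ m, m < B m + ℓ := by
    intro m
    have h1 := Nat.lt_mul_div_succ m hℓpos
    have h2 : ℓ * (m / ℓ + 1) = m / ℓ * ℓ + ℓ := by ring
    show m < m / ℓ * ℓ + ℓ
    omega
  have hB3 : ∀ m, B (B m) = B m := by
    intro m
    show m / ℓ * ℓ / ℓ * ℓ = m / ℓ * ℓ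
    rw [Nat.mul_div_cancel _ hℓpos]
  have hB4 : ∀ m, m < k * ℓ → B m + ℓ ≤ k * ℓ := by
    intro m hm
    have h1 : m / ℓ < k := (Nat.div_lt_iff_lt_mul hℓpos).2 hm
    have h2 : (m / ℓ + 1) * ℓ ≤ k * ℓ := Nat.mul_le_mul_right ℓ h1
    show m / ℓ * ℓ + ℓ ≤ k * ℓ
    rwa [Nat.succ_mul] at h2
  have hB5 : ∀ m m', B m ≤ m' → m' < B m + ℓ → B m' = B m := by
    intro m m' h1 h2
    show m' / ℓ * ℓ = m / ℓ * ℓ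
    have h2' : m' < (m / ℓ + 1) * ℓ := by rwa [Nat.succ_mul]
    rw [Nat.div_eq_of_lt_le h1 h2']
  -- the last anchor `P = k ℓ`
  set P : ℕ := k * ℓ with hPdef
  refine ⟨fun m => if P ≤ m then P else B m, fun a => if P ≤ a then N - P else ℓ,
    ?_, ?_, ?_, ?_, ?_⟩
  · -- `A m ≤ m`
    intro m
    by_cases hm : P ≤ m
    · simp only [if_pos hm]
      exact hm
    · simp only [if_neg hm]
      exact hB1 m
  · -- `A (A m) = A m`
    intro m
    by_cases hm : P ≤ m
    · simp only [if_pos hm, if_pos le_rfl]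
    · simp only [if_neg hm]
      have hBm : ¬ P ≤ B m := fun h => hm (h.trans (hB1 m))
      rw [if_neg hBm, hB3]
  · -- `ℓ ≤ len (A m) < 2ℓ`
    intro m
    by_cases hm : P ≤ m
    · simp only [if_pos hm, if_pos le_rfl]
      omega
    · simp only [if_neg hm]
      have hBm : ¬ P ≤ B m := fun h => hm (h.trans (hB1 m))
      rw [if_neg hBm]
      omega
  · -- `A m + len (A m) ≤ N`
    intro m
    by_cases hm : P ≤ m
    · simp only [if_pos hm, if_pos le_rfl]
      omega
    · simp only [if_neg hm]
      have hBm : ¬ P ≤ B m := fun h => hm (h.trans (hB1 m))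
      rw [if_neg hBm]
      have := hB4 m (Nat.lt_of_not_le hm)
      omega
  · -- block membership
    intro m m' hm'
    by_cases hm : P ≤ m
    · simp only [if_pos hm, if_pos le_rfl]
      by_cases hPm' : P ≤ m'
      · rw [if_pos hPm']
        exact ⟨fun _ => ⟨hPm', by omega⟩, fun _ => rfl⟩
      · rw [if_neg hPm']
        have h1 := hB1 m'
        constructor
        · intro h
          exfalso
          omega
        · intro h
          exfalso
          exact hPm' h.1
    · simp only [if_neg hm]
      have hBm : ¬ P ≤ B m := fun h => hm (h.trans (hB1 m))
      rw [if_neg hBm]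
      have h4 := hB4 m (Nat.lt_of_not_le hm)
      by_cases hPm' : P ≤ m'
      · rw [if_pos hPm']
        constructor
        · intro h
          exfalso
          exact hBm h.le
        · intro h
          exfalso
          omega
      · rw [if_neg hPm']
        constructor
        · intro h
          rw [← h]
          exact ⟨hB1 m', hB2 m'⟩
        · intro h
          exact hB5 m m' h.1 h.2

/-- **Intervals on the cycle `ℤ/N` through `ZMod.val`.** If `c.val + L ≤ N` then
`(w - c).val < L ↔ c.val ≤ w.val < c.val + L`: the interval `[c, c + L)` of the cycle does not
wrap around. [folklore] -/
theorem zmod_val_sub_lt_iff {N : ℕ} [NeZero N] (w c : ZMod N) (L : ℕ) (h : c.val + L ≤ N) :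
    (w - c).val < L ↔ c.val ≤ w.val ∧ w.val < c.val + L := by
  rcases Nat.lt_or_ge w.val c.val with hlt | hle
  · have hne : c - w ≠ 0 := by
      intro h0
      rw [sub_eq_zero] at h0
      rw [h0] at hlt
      exact lt_irrefl _ hlt
    have h1 : (c - w).val = c.val - w.val := ZMod.val_sub hlt.le
    have h2 : (w - c).val = N - (c.val - w.val) := by
      rw [← neg_sub c w, ZMod.neg_val, if_neg hne, h1]
    rw [h2]
    constructor
    · intro h3
      exfalso
      omega
    · intro h3
      exfalso
      omega
  · rw [ZMod.val_sub hle]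
    omega

/-- **Blocking of the discrete torus `(ℤ/N)³` into boxes with sides in `[ℓ, 2ℓ)`.** For
`1 ≤ ℓ ≤ N` there are an idempotent anchor map `anc : (ℤ/N)³ → (ℤ/N)³` and side lengths
`L : (ℤ/N)³ → Fin 3 → ℕ` with `ℓ ≤ L (anc x) i < 2ℓ` such that `anc y = anc x` iff `y` lies in the
box `∏ᵢ [anc x i, anc x i + L (anc x) i)` (membership read through `ZMod.val` of the difference):
write `N = q ℓ + r` (`q ≥ 1`, `r < ℓ`), cut each coordinate cycle into
`[0,ℓ), …, [(q-2)ℓ,(q-1)ℓ), [(q-1)ℓ, N)` (`nat_blocking`) and take the product of the three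
coordinate blockings. [folklore] -/
theorem torus_blocking : ∀ (ℓ N : ℕ) [NeZero N], 1 ≤ ℓ → ℓ ≤ N → ∃ (anc : TorusSite 3 N → TorusSite 3 N) (L : TorusSite 3 N → Fin 3 → ℕ), (∀ x, anc (anc x) = anc x) ∧ (∀ x (i : Fin 3), ℓ ≤ L (anc x) i ∧ L (anc x) i < 2 * ℓ) ∧ (∀ x y : TorusSite 3 N, anc y = anc x ↔ ∀ i : Fin 3, (y i - anc x i).val < L (anc x) i) := by
  intro ℓ N _ hℓ hℓN
  have hℓpos : 0 < ℓ := hℓ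
  -- `N = q ℓ + r` with `q ≥ 1`, `r < ℓ`; `k = q - 1`
  have hq : 1 ≤ N / ℓ := Nat.div_pos hℓN hℓpos
  have hdm := Nat.div_add_mod N ℓ
  have hml := Nat.mod_lt N hℓpos
  obtain ⟨k, hk⟩ : ∃ k, N / ℓ = k + 1 := ⟨N / ℓ - 1, by omega⟩
  have e : ℓ * (N / ℓ) = k * ℓ + ℓ := by rw [hk]; ring
  rw [e] at hdm
  obtain ⟨A, len, hAle, hAA, hlen, hAN, hblock⟩ :=
    nat_blocking ℓ N k hℓ (by omega) (by omega)
  -- one-dimensional anchor on `ZMod N`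
  set anc₁ : ZMod N → ZMod N := fun z => ((A z.val : ℕ) : ZMod N) with hanc₁
  have hval : ∀ z : ZMod N, (anc₁ z).val = A z.val := fun z =>
    ZMod.val_natCast_of_lt ((hAle _).trans_lt (ZMod.val_lt z))
  refine ⟨fun x i => anc₁ (x i), fun x i => len (x i).val, ?_, ?_, ?_⟩
  · intro x
    funext i
    show anc₁ (anc₁ (x i)) = anc₁ (x i)
    apply ZMod.val_injective N
    rw [hval, hval, hAA]
  · intro x i
    show ℓ ≤ len (anc₁ (x i)).val ∧ len (anc₁ (x i)).val < 2 * ℓ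
    rw [hval]
    exact hlen _
  · intro x y
    show ((fun i => anc₁ (y i)) = fun i => anc₁ (x i)) ↔
      ∀ i : Fin 3, (y i - anc₁ (x i)).val < len (anc₁ (x i)).val
    rw [funext_iff]
    refine forall_congr' fun i => ?_
    rw [← (ZMod.val_injective N).eq_iff, hval (y i), hval (x i),
      hblock (x i).val (y i).val (ZMod.val_lt _),
      zmod_val_sub_lt_iff (y i) (anc₁ (x i)) (len (A (x i).val)) (by rw [hval]; exact hAN _),
      hval (x i)]

end Summit.QuantumFields.YangMills.Theorems.AnchorGap
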